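import Mathlib.AlgebraicGeometry.Group.Abelian
import Mathlib.AlgebraicGeometry.Morphisms.Finite
import Mathlib.CategoryTheory.Monoidal.Grp
import Mathlib.CategoryTheory.Monoidal.Cartesian.Grp
import Mathlib.CategoryTheory.InducedCategory
import Mathlib.CategoryTheory.Preadditive.Basic
import Mathlib.RingTheory.TensorProduct.Basic
import Mathlib.FieldTheory.IsAlgClosed.AlgebraicClosure
import Literature.AlgebraicGeometry.Motives.Varieties
import Literature.AlgebraicGeometry.Motives.AlgPoints
import HarnessLib

-- provenance: harness21/H21/H21/Prelude/MotiveAbstract/AbelianVariety.lean @ 7f20f4c (interim HEAD d8f2665); M5 mechanical rewrite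
/-!
# Abelian varieties (trunk T-MOTIVE, prelude C3)

An *abelian variety* over a field `k` is a proper, geometrically integral group scheme over `k`
(Mumford, *Abelian Varieties*, §4; Stacks 0BF9). Smoothness is automatic (Stacks 047N) and so is
commutativity (Mumford §4, "rigidity"; Stacks 0BFD), the latter being Mathlib's
`AlgebraicGeometry.isCommMonObj_of_isProper_of_geometricallyIntegral`, which we use to derive the
`IsCommMonObj` instance with a real proof.

## Design

We follow Mathlib's `CommGrp C` pattern (`Mathlib/CategoryTheory/Monoidal/CommGrp_.lean`) verbatim:

* `Literature.AbelianVariety k` bundles `X : SchemeOver k` (= `Over (Spec k)`) with a group-object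
  structure `[GrpObj X]` and the two properties;
* `A.toGrp : Grp (SchemeOver k)` and `Category (AbelianVariety k)` is the category *induced* along
  `toGrp`, so morphisms `A ⟶ B` are Mathlib's homomorphisms of group schemes
  (`InducedCategory.Hom` wrapping `Grp.Hom`);
* since `A.X` is a commutative group object in a cartesian monoidal category, Mathlib's scoped
  instance `Hom.commGroup` (`Mathlib/CategoryTheory/Monoidal/Cartesian/Grp_.lean`) makes
  `A.toGrp ⟶ B.toGrp` a commutative group; we transport it to `AddCommGroup (A ⟶ B)` and prove
  bilinearity of composition, giving `Preadditive (AbelianVariety k)`. Consequently `End A` is a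
  ring by Mathlib's `Preadditive` instance — no bespoke ring instance is declared here;
* `A.endAlgebra = ℚ ⊗[ℤ] End A` is the endomorphism algebra `End⁰(A)`;
* `A.Points L = AlgPoints A.X L` (`= specOver k L ⟶ A.X`), so the Galois action and the strong
  topology of `Literature.AlgebraicGeometry.Motives.AlgPoints` and Mathlib's scoped `CommGroup` structure live on the same type;
  `A.torsionPoints L n = A[n](L)` is the kernel of `P ↦ P ^ n`.

Mathlib has no bundled abelian varieties (searched `AbelianVariety`, `Isogeny` in `Mathlib/`:
no hits outside `Mathlib/AlgebraicGeometry/Group/Abelian.lean`, which only proves commutativity).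

## Deferred

The dual abelian variety, polarisations, the Rosati involution and Poincaré complete reducibility
(as a decomposition up to isogeny) all need `Pic⁰` / line bundles on schemes, which Mathlib lacks;
they are not defined here.

## References

* D. Mumford, *Abelian Varieties*, §§4, 6, 7, 19 and Appendix to §7.
* J. S. Milne, *Abelian Varieties* (course notes), §§1, 7, 8.
* The Stacks project, Tags 0BF9, 0BFD, 047N, 03RP.
-/

universe u

open CategoryTheory AlgebraicGeometry MonoidalCategory
open scoped TensorProduct

noncomputable section

namespace Literature.AlgebraicGeometry.Motives

/-- An *abelian variety* over the field `k`: a `k`-group scheme `X` (a group object in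
`Over (Spec k)`) whose structure morphism is proper and geometrically integral
(Mumford, *Abelian Varieties* §4, Definition; Stacks 0BF9). Smoothness (Stacks 047N) and
commutativity (Stacks 0BFD, see `AbelianVariety.instIsCommMonObj`) follow. [folklore] -/
structure AbelianVariety (k : Type u) [Field k] where
  /-- The underlying `k`-scheme. -/
  X : SchemeOver k
  /-- The group-scheme structure on `X`. -/
  [grpObj : GrpObj X]
  /-- `X → Spec k` is proper. -/
  isProper : IsProper X.hom
  /-- `X → Spec k` is geometrically integral. -/
  geometricallyIntegral : GeometricallyIntegral X.hom

attribute [instance] AbelianVariety.grpObj AbelianVariety.isProper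
  AbelianVariety.geometricallyIntegral

namespace AbelianVariety

variable {k : Type u} [Field k]

/-- An abelian variety is a group object in `k`-schemes (Mumford §4). This is the map along which
the category structure is induced, exactly as Mathlib's `CommGrp.toGrp`. [folklore] -/
@[simps -isSimp X]
abbrev toGrp (A : AbelianVariety k) : Grp (SchemeOver k) := ⟨A.X⟩

/-- Morphisms of abelian varieties are homomorphisms of `k`-group schemes: the category structure
is induced from `Grp (SchemeOver k)` along `toGrp` (Mumford §4; cf. Mathlib's
`CommGrp.instCategory`). By rigidity every morphism of varieties preserving the identity is a
homomorphism (Mumford §4 Cor. 1), so nothing is lost. [folklore] -/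
instance instCategory : Category (AbelianVariety k) :=
  inferInstanceAs (Category (InducedCategory _ AbelianVariety.toGrp))

/-- The identity of an abelian variety is the identity group-scheme homomorphism
(cf. Mathlib `CommGrp.id_hom`). [folklore] -/
@[simp]
theorem id_hom (A : AbelianVariety k) : (InducedCategory.Hom.hom (𝟙 A)) = 𝟙 A.toGrp :=
  rfl

/-- Composition of morphisms of abelian varieties is composition of group-scheme homomorphisms
(cf. Mathlib `CommGrp.comp_hom`). [folklore] -/
@[simp]
theorem comp_hom {A B C : AbelianVariety k} (f : A ⟶ B) (g : B ⟶ C) :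
    (f ≫ g).hom = f.hom ≫ g.hom :=
  rfl

/-- Two morphisms of abelian varieties are equal if their underlying morphisms of `k`-schemes are
(cf. Mathlib `CommGrp.hom_ext`). [folklore] -/
@[ext]
theorem hom_ext {A B : AbelianVariety k} (f g : A ⟶ B) (h : f.hom.hom.hom = g.hom.hom.hom) :
    f = g :=
  InducedCategory.hom_ext (Grp.hom_ext _ _ h)

/-- The underlying morphism of schemes `A → B` of a morphism of abelian varieties
(forgetting the group structure and the structure maps to `Spec k`; Mumford §4). [folklore] -/
abbrev Hom.toSchemeHom {A B : AbelianVariety k} (f : A ⟶ B) : A.X.left ⟶ B.X.left :=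
  f.hom.hom.hom.left

variable (A B C : AbelianVariety k)

/-- Abelian varieties are commutative group schemes (Mumford §4, Corollary 2 of the rigidity
lemma; Stacks 0BFD). Real proof: Mathlib's
`AlgebraicGeometry.isCommMonObj_of_isProper_of_geometricallyIntegral`. [folklore] -/
instance instIsCommMonObj : IsCommMonObj A.X :=
  isCommMonObj_of_isProper_of_geometricallyIntegral A.X

open scoped MonObj

/-- `Hom(A, B)` is an abelian group under pointwise addition `(f + g)(x) = f(x) + g(x)`
(Mumford §19, first paragraph). This is Mathlib's scoped `CommGroup (A.toGrp ⟶ B.toGrp)`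
(`Hom.commGroup`, valid since `B.X` is a commutative group object) transported to additive
notation along `InducedCategory.homEquiv`. [folklore] -/
instance instAddCommGroupHom : AddCommGroup (A ⟶ B) :=
  (InducedCategory.homEquiv.trans Additive.ofMul).addCommGroup

variable {A B C}

/-- Addition of morphisms of abelian varieties is the (multiplicatively written) pointwise
product of group-scheme homomorphisms in Mathlib's `Hom.commGroup`. [folklore] -/
theorem hom_add (f g : A ⟶ B) : (f + g).hom = f.hom * g.hom := rfl

/-- The zero morphism of abelian varieties is the trivial homomorphism. [folklore] -/
theorem hom_zero : (0 : A ⟶ B).hom = 1 := rfl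

/-- The category of abelian varieties over `k` is preadditive: composition is bilinear
(Mumford §19). Real proofs via Mathlib's `MonObj.mul_comp` / `MonObj.comp_mul`; the resulting
`Ring (End A)` is Mathlib's `Preadditive` endomorphism ring. [folklore] -/
instance instPreadditive : Preadditive (AbelianVariety k) where
  add_comp P Q R f f' g := by
    apply InducedCategory.hom_ext
    apply Grp.hom_ext
    change ((f.hom * f'.hom) ≫ g.hom).hom.hom = _
    simp only [hom_add]
    simp [Grp.Hom.hom_mul, MonObj.mul_comp]
  comp_add P Q R f g g' := by
    apply InducedCategory.hom_ext
    apply Grp.hom_ext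
    change (f.hom ≫ (g.hom * g'.hom)).hom.hom = _
    simp only [hom_add]
    simp [Grp.Hom.hom_mul, MonObj.comp_mul]

variable (A B C)

/-! ### The endomorphism algebra -/

/-- The endomorphism algebra `End⁰(A) = ℚ ⊗_ℤ End(A)` of an abelian variety
(Mumford §19, "The structure of End⁰(X)"). [folklore] -/
def endAlgebra : Type u := ℚ ⊗[ℤ] End A

/-- `End⁰(A)` is a ring (Mumford §19); Mathlib's `Algebra.TensorProduct.instRing`, given as an
explicit term because instance search does not unfold `endAlgebra`. [folklore] -/
instance endAlgebra.instRing : Ring (endAlgebra A) := Algebra.TensorProduct.instRing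

/-- `End⁰(A)` is a `ℚ`-algebra (Mumford §19); Mathlib's `Algebra.TensorProduct.leftAlgebra`. [folklore] -/
instance endAlgebra.instAlgebra : Algebra ℚ (endAlgebra A) := Algebra.TensorProduct.leftAlgebra

/-- The canonical ring homomorphism `End(A) → End⁰(A)`, `φ ↦ 1 ⊗ φ` (Mumford §19). It is
injective since `End(A)` is torsion-free (Mumford §19 Thm. 3), not proved here. [folklore] -/
def endAlgebra.of : End A →+* endAlgebra A :=
  (Algebra.TensorProduct.includeRight (R := ℤ) (A := ℚ) (B := End A)).toRingHom

/-! ### Dimension, isogenies, simplicity -/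

/-- The dimension of an abelian variety, i.e. the dimension of its underlying scheme
(`Literature.AlgebraicGeometry.Motives.schemeDim`; Mumford §4). [folklore] -/
def dim : ℕ := schemeDim A.X.left

/-- An abelian variety of dimension `g` is a smooth projective geometrically integral variety of
dimension `g` over `k`: smoothness by Stacks 047N (Mumford §4 (ii)), projectivity by
Mumford §6, Application 1, p. 62 (and §7 over arbitrary fields). [cite: MumfordAV1970, §4 (ii) and §6 Application 1 (p. 62)] [cite: StacksProject, Tag 047N] -/
def isSmoothProjective : Prop :=
  IsSmoothProjective A.dim A.X

variable {A B C}

/-- A morphism of abelian varieties is an *isogeny* if it is surjective with finite kernel,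
equivalently surjective and finite (Mumford §7, Application 3, p. 63; Milne, *Abelian Varieties*
§8). [folklore] -/
def IsIsogeny (f : A ⟶ B) : Prop :=
  Surjective (Hom.toSchemeHom f) ∧ IsFinite (Hom.toSchemeHom f)

/-- Two abelian varieties are *isogenous* if there is an isogeny `A → B` (Mumford §7, §19).
This is a predicate on the pair `(A, B)` (a definition, not an assertion); the binders are written
explicitly in the signature so that the declaration reads as the two-argument predicate it is. [folklore] -/
def IsIsogenous (A B : AbelianVariety k) : Prop := ∃ f : A ⟶ B, IsIsogeny f

/-- The identity is an isogeny. [folklore] -/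
theorem isIsogeny_id (A : AbelianVariety k) : IsIsogeny (𝟙 A) := by
  constructor
  · change Surjective (𝟙 A.X.left)
    infer_instance
  · change IsFinite (𝟙 A.X.left)
    infer_instance

/-- Isogeny is reflexive. [folklore] -/
theorem IsIsogenous.refl (A : AbelianVariety k) : IsIsogenous A A := ⟨𝟙 A, isIsogeny_id A⟩

/-- Isogeny is symmetric: if `f : A → B` is an isogeny of degree `n` there is an isogeny
`g : B → A` with `g ∘ f = [n]` (Mumford §19, Remark before Thm. 1, p. 169; Milne §8, 8.5). [cite: MumfordAV1970, §19 (remark before Thm. 1, p. 169)] -/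
def IsIsogenous.symm : Prop :=
  ∀ (h : IsIsogenous A B),
    IsIsogenous B A

/-- Composites of isogenies are isogenies (Mumford §19; surjective and finite morphisms compose). [folklore] -/
theorem isIsogeny_comp {f : A ⟶ B} {g : B ⟶ C} (hf : IsIsogeny f) (hg : IsIsogeny g) :
    IsIsogeny (f ≫ g) := by
  obtain ⟨_, _⟩ := hf
  obtain ⟨_, _⟩ := hg
  constructor
  · change Surjective (Hom.toSchemeHom f ≫ Hom.toSchemeHom g)
    infer_instance
  · change IsFinite (Hom.toSchemeHom f ≫ Hom.toSchemeHom g)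
    infer_instance

/-- Isogeny is transitive: composites of isogenies are isogenies (Mumford §19). [folklore] -/
theorem IsIsogenous.trans (hAB : IsIsogenous A B) (hBC : IsIsogenous B C) : IsIsogenous A C := by
  obtain ⟨f, hf⟩ := hAB
  obtain ⟨g, hg⟩ := hBC
  exact ⟨f ≫ g, isIsogeny_comp hf hg⟩

/-- Isogenous abelian varieties have the same dimension (Mumford §7, Application 3, p. 63:
an isogeny is finite surjective). [cite: MumfordAV1970, §7 Application 3 (p. 63)] -/
def dim_eq_of_isIsogenous : Prop :=
  ∀ (h : IsIsogenous A B),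
    A.dim = B.dim

/-- An abelian variety `A` is *simple* if it has no abelian subvariety other than `0` and `A`:
there is no abelian variety `B` with a closed-immersion homomorphism `B → A` and
`0 < dim B < dim A` (Mumford §19, Definition before Cor. 2 of Thm. 1, p. 173; Milne, *Abelian
Varieties* (in Cornell–Silverman, *Arithmetic Geometry*), §12, p. 122: "simple if it has no proper
nonzero abelian subvarieties"). This is a predicate on `A` (a definition, not an assertion: a product
of two elliptic curves is not simple), written with its binder explicit in the signature; see
`isSimple_of_dim_le_one` for the abelian varieties of dimension `≤ 1`. [folklore] -/
def IsSimple (A : AbelianVariety k) : Prop :=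
  ∀ (B : AbelianVariety k) (f : B ⟶ A), IsClosedImmersion (Hom.toSchemeHom f) →
    0 < B.dim → B.dim < A.dim → False

/-- Abelian varieties of dimension `≤ 1` are simple: an abelian subvariety `B ↪ A` with
`0 < dim B < dim A ≤ 1` cannot exist. In particular elliptic curves (abelian varieties of
dimension `1`) are simple, and so is the zero abelian variety under this convention
(Milne, *Abelian Varieties* (in Cornell–Silverman, *Arithmetic Geometry*), §12, p. 122, definition
of "simple"; immediate from the definition). [cite: Milne1986AbelianVarieties, §12 p. 122 (definition of a simple abelian variety)] -/
theorem isSimple_of_dim_le_one (hA : A.dim ≤ 1) : IsSimple A := by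
  intro B _ _ hB hBA
  omega

/-! ### Points and torsion points -/

variable (A)
variable (L : Type u) [Field L] [Algebra k L]

/-- The `L`-valued points `A(L)` of an abelian variety over `k`, for a field extension `L / k`:
`k`-morphisms `Spec L → A`. This is `Literature.AlgPoints A.X L`, so it carries the strong topology and
the Galois action of that file, and Mathlib's scoped `Hom.commGroup` makes it a commutative group
(Mumford §4). [folklore] -/
abbrev Points : Type u := AlgPoints A.X L

/-- `A(L)` is a commutative group (Mumford §4); this is Mathlib's scoped instance
`Hom.commGroup` for the commutative group object `A.X`, recorded here so that it is available
without `open scoped MonObj`. [folklore] -/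
instance Points.instCommGroup : CommGroup (A.Points L) := inferInstance

/-- The `n`-torsion points `A[n](L) = ker (P ↦ P ^ n)` of `A(L)` (written multiplicatively, as
in Mathlib's `Hom.commGroup`), for `n : ℤ` (Mumford §6, p. 64). [folklore] -/
def torsionPoints (n : ℤ) : Subgroup (A.Points L) := (zpowGroupHom n).ker

variable {A L}

/-- Membership in `A[n](L)` unfolds to `P ^ n = 1`. [folklore] -/
theorem mem_torsionPoints_iff (n : ℤ) (P : A.Points L) :
    P ∈ A.torsionPoints L n ↔ P ^ n = 1 :=
  Iff.rfl

/-- The `n`-torsion `A[n](L)` is stable under the Galois action of `Aut(L/k)` on `A(L)`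
(the group law is defined over `k`; Mumford §6, Serre–Tate). [cite: MumfordAV1970, §6 (group law defined over k)] -/
def smul_mem_torsionPoints : Prop :=
  ∀ (n : ℤ) (σ : L ≃ₐ[k] L) {P : A.Points L} (hP : P ∈ A.torsionPoints L n),
    σ • P ∈ A.torsionPoints L n

variable (A L) in
/-- Over an algebraically closed field `L ⊇ k` and for `n` invertible in `k`, the `n`-torsion of a
`g`-dimensional abelian variety has exactly `n ^ (2 g)` points, `A[n](L) ≃ (ℤ/nℤ)^{2g}`
(Mumford §6, Application 3 / Proposition p. 64, and Appendix to §7 in characteristic `p ∤ n`). [cite: MumfordAV1970, §6 Application 3 (Proposition p. 64) and Appendix to §7] -/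
def natCard_torsionPoints_of_isAlgClosed : Prop :=
  ∀ [IsAlgClosed L] (n : ℤ) (hn : (n : k) ≠ 0),
    Nat.card (A.torsionPoints L n) = n.natAbs ^ (2 * A.dim)

/-! ### Galois acts by group automorphisms; discharge of `smul_mem_torsionPoints` -/

variable (A L) in
/-- `Aut(L/k)` acts on `A(L)` by group automorphisms: `σ • (P * Q) = σ • P * σ • Q` and
`σ • 1 = 1`. Since `σ • P = specMap σ ≫ P` (`AlgPoints.smul_def`) and the group law on
`A(L) = Hom_k(Spec L, A.X)` is induced from the `k`-group scheme `A.X` (Mathlib `Hom.commGroup`),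
precomposition with `specMap σ` is a homomorphism (Mathlib `MonObj.comp_mul`, `MonObj.comp_one`).
Informally: the group law and the unit section are morphisms defined over `k`
(Mumford, *Abelian Varieties*, §6), which is the fact behind `([m]P)^σ = [m](P^σ)`, `O^σ = O` in
Silverman, *The Arithmetic of Elliptic Curves* (2nd ed.), §III.7, first paragraph, p. 87.
Consequences available from Mathlib: `smul_inv'`, `smul_div'`, `smul_zpow'`, `smul_pow'`.
[cite: MumfordAV1970, §6 (group law defined over k)] [cite: SilvermanAEC2009, §III.7 p. 87 (first paragraph)] -/
instance Points.instMulDistribMulAction : MulDistribMulAction (L ≃ₐ[k] L) (A.Points L) where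
  smul_mul σ P Q := by
    change AlgPoints.specMap σ ≫ (P * Q) = (AlgPoints.specMap σ ≫ P) * (AlgPoints.specMap σ ≫ Q)
    exact MonObj.comp_mul _ _ _
  smul_one σ := by
    change AlgPoints.specMap σ ≫ (1 : A.Points L) = 1
    exact MonObj.comp_one _

/-- The Galois action commutes with integer powers in `A(L)`: `(σ • P) ^ n = σ • (P ^ n)`, i.e.
`[n](P^σ) = ([n]P)^σ` (Silverman, *AEC* (2nd ed.), §III.7, p. 87, first paragraph; for abelian
varieties because `[n]` is defined over `k`, Mumford, *Abelian Varieties*, §6). This is Mathlib's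
`smul_zpow'` for `Points.instMulDistribMulAction`, equivalently `GrpObj.comp_zpow`.
[cite: SilvermanAEC2009, §III.7 p. 87 (first paragraph)] -/
theorem Points.zpow_smul (σ : L ≃ₐ[k] L) (P : A.Points L) (n : ℤ) :
    (σ • P) ^ n = σ • (P ^ n) :=
  (smul_zpow' σ P n).symm

/-- **Discharge of `smul_mem_torsionPoints`.** The `n`-torsion `A[n](L)` is stable under
`Aut(L/k)`: if `P ^ n = 1` then `(σ • P) ^ n = σ • (P ^ n) = σ • 1 = 1`, exactly the argument
`[m](P^σ) = ([m]P)^σ = O^σ = O` of Silverman, *The Arithmetic of Elliptic Curves* (2nd ed.),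
§III.7, first paragraph, p. 87 (printed there for elliptic curves; it uses only that the group
law, hence `[n]`, and the unit section are `k`-morphisms — Mumford, *Abelian Varieties*, §6 —
which here is `Points.instMulDistribMulAction`). Real proof: Mathlib `smul_zpow'`, `smul_one`
(ultimately `GrpObj.comp_zpow`, `MonObj.comp_one`).
[cite: MumfordAV1970, §6 (group law defined over k)] [cite: SilvermanAEC2009, §III.7 p. 87 (first paragraph)] -/
theorem smul_mem_torsionPoints_holds : smul_mem_torsionPoints (A := A) (L := L) := by
  intro n σ P hP
  rw [mem_torsionPoints_iff] at hP ⊢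
  rw [← smul_zpow', hP, smul_one]

/-- Corollary in subgroup form: `σ • A[n](L) ≤ A[n](L)`, i.e. each `A[n](L)` is a
`Aut(L/k)`-stable subgroup of `A(L)` (Silverman, *AEC* (2nd ed.), §III.7, p. 87: "each element
`σ` of the Galois group acts on `E[m]`"). [cite: SilvermanAEC2009, §III.7 p. 87 (first paragraph)] -/
theorem smul_mem_torsionPoints_iff (n : ℤ) (σ : L ≃ₐ[k] L) (P : A.Points L) :
    σ • P ∈ A.torsionPoints L n ↔ P ∈ A.torsionPoints L n := by
  refine ⟨fun h => ?_, fun h => smul_mem_torsionPoints_holds n σ h⟩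
  have h' := smul_mem_torsionPoints_holds n σ⁻¹ h
  rwa [inv_smul_smul] at h'

end AbelianVariety

end Literature.AlgebraicGeometry.Motives
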